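import Mathlib
import HarnessLib
import HarnessLib.Audit
import Summits.AtomisticToContinuum.Statement

/-!
Route: CollisionMeasureChaos

CLOSED (retired) 2026-08-15T13:41:18Z by operator:999:1257524 — reason: not-a-thesis: assembly does not conclude the sub-problem Statement — note: D-0027 §2.1 audit (human 2026-08-15: routes that do not decide the summit are removed): the assembly concludes `Literature.MathematicalPhysics.KineticTheory.HydrodynamicLimit`, not the sub-problem statement; a NEW conforming route may be opened from the same idea (generated `closes : … → _root_.Hydr. The file is kept as the record of this route; refuted decls are indexed as negative knowledge (`ledger negatives`).

# Route CollisionMeasureChaos — Euler at fixed density = averaged molecular chaos of the limit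
collision measure

It suffices to show X = ContactChaos ∧ CollisionRate ∧ LocalSecondLaw ∧ DensityCap (card
limit-collision-measure-chaos, its cruxes 1–2
re-cut by the planner, see § Why this line). Pass to the limit PAIR (μ̄, κ̄) of the empirical
one-particle measure μ^N and the normalised
empirical COLLISION measure κ^N = (ε_N/(N+1)) Σ_{collisions} δ_{(t, x, ω, v⁻, v*⁻)} of ONE
hard-sphere trajectory (ε_N = σ(N+1)^{-1/3};
collision times, contact pairs and pre-collisional velocities are read off the library trajectory
API). Tightness and the exact
Bogolyubov / Pulvirenti–Simonella identity for (μ^N, κ^N) are free; dividing the identity by the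
collision frequency ν_N ≍ N^{1/3} gives
COLLISIONAL BALANCE ∫[φ(v′)+φ(v*′)−φ(v)−φ(v*)] dκ̄_{t,x} = 0 for free, so Boltzmann's 1872 rigidity
(measure version, support
BalanceRigidity) makes μ̄_{t,x} Maxwellian as soon as κ̄ has PRODUCT STRUCTURE: ContactChaos =
κ̄_{t,x} = λ(t,x)((v−v*)·ω)₋ dω μ̄_{t,x}⊗μ̄_{t,x}
(finite-N form: a mollified cross-ratio defect vanishes in probability, N → ∞ then mollifier r → 0);
CollisionRate = λ = σ³Y(σ³ρ̄) with the
thermodynamic contact value Y = (3/2π) f_ex′ below reduced density η₀; LocalSecondLaw = local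
entropy inequality of the mollified empirical
fields in probability; DensityCap = no overcompression beyond the Euler density before T. Then the
five conservation laws close with
p = hsPressure, and Feireisl-type weak–strong uniqueness for the complete Euler system gives the
conjunct.
Lean: `(∀ (a₀ θ₀ : Literature.MathematicalPhysics.KineticTheory.T3 → ℝ) (u₀ :
Literature.MathematicalPhysics.KineticTheory.T3 → Literature.MathematicalPhysics.KineticTheory.V3),
Continuous a₀ → Continuous θ₀ → Continuous u₀ → (∀ x, 0 < a₀ x) → (∀ x, 0 < θ₀ x) → ∃ σ₀ : ℝ, 0 < σ₀
∧ ∀ σ : ℝ, 0 < σ → σ < σ₀ → ∀ Φ : (N : ℕ) → Literature.Analysis.FluidPDE.HardSphereFlow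
(Literature.Analysis.FluidPDE.Torus.geometry (Fin 3))
(Literature.MathematicalPhysics.KineticTheory.hsDiameter σ N) (N + 1), ∀ τ : ℝ, 0 < τ → ∀ χ : ℝ ×
Literature.MathematicalPhysics.KineticTheory.T3 → ℝ, Continuous χ → ∀ Ψ :
Literature.MathematicalPhysics.KineticTheory.V3 × Literature.MathematicalPhysics.KineticTheory.V3 ×
Literature.MathematicalPhysics.KineticTheory.V3 → ℝ, Continuous Ψ → (∃ C : ℝ, ∀ p, |Ψ p| ≤ C) → ∀ η
δ : ℝ, 0 < η → 0 < δ → ∃ r₀ : ℝ, 0 < r₀ ∧ ∀ r : ℝ, 0 < r → r < r₀ → ∃ N₀ : ℕ, ∀ N : ℕ, N₀ ≤ N → let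
ε := Literature.MathematicalPhysics.KineticTheory.hsDiameter σ N; let G :
Literature.Analysis.FluidPDE.Geometry (Fin 3) Literature.MathematicalPhysics.KineticTheory.T3 :=
Literature.Analysis.FluidPDE.Torus.geometry (Fin 3); let γ : Literature.Analysis.FluidPDE.Config (N
+ 1) (Fin 3) Literature.MathematicalPhysics.KineticTheory.T3 → ℝ →
Literature.Analysis.FluidPDE.Config (N + 1) (Fin 3) Literature.MathematicalPhysics.KineticTheory.T3
:= fun z s => (Φ N).flow s z; let bx : Literature.MathematicalPhysics.KineticTheory.T3 →
Literature.MathematicalPhysics.KineticTheory.T3 → ℝ := fun x y => 3 / (Real.pi * r ^ 3) * max (1 -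
Literature.Analysis.FluidPDE.Torus.euclidDist x y / r) 0; let bt : ℝ → ℝ := fun a => r⁻¹ * max (1 -
|a| / r) 0; let Θ := fun (Ξ : Literature.MathematicalPhysics.KineticTheory.V3 ×
Literature.MathematicalPhysics.KineticTheory.V3 × Literature.MathematicalPhysics.KineticTheory.V3 →
ℝ) (v w : Literature.MathematicalPhysics.KineticTheory.V3) => ∫ ω : Metric.sphere (0 :
Literature.MathematicalPhysics.KineticTheory.V3) 1, Ξ ((ω :
Literature.MathematicalPhysics.KineticTheory.V3), v, w) *
Literature.MathematicalPhysics.KineticTheory.hardSphereKernel (w, v) ω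
∂Literature.MathematicalPhysics.KineticTheory.sphereMeasure; let Pm :
(Literature.MathematicalPhysics.KineticTheory.V3 → Literature.MathematicalPhysics.KineticTheory.V3 →
ℝ) → Literature.Analysis.FluidPDE.Config (N + 1) (Fin 3)
Literature.MathematicalPhysics.KineticTheory.T3 → ℝ →
Literature.MathematicalPhysics.KineticTheory.T3 → ℝ := fun Th z s₀ x₀ => ∫ s in Set.Icc (0 : ℝ) τ,
bt (s - s₀) * ∫ p, bx p.1.1 x₀ * bx p.2.1 x₀ * Th p.1.2 p.2.2
∂((Literature.Analysis.FluidPDE.empiricalMeasure (γ z s)).prod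
(Literature.Analysis.FluidPDE.empiricalMeasure (γ z s))); let Kc :
(Literature.Analysis.FluidPDE.Config (N + 1) (Fin 3) Literature.MathematicalPhysics.KineticTheory.T3
→ ℝ → Fin (N + 1) → Fin (N + 1) → ℝ) → Literature.Analysis.FluidPDE.Config (N + 1) (Fin 3)
Literature.MathematicalPhysics.KineticTheory.T3 → ℝ := fun F z => ε / (N + 1 : ℝ) * ∑ᶠ (s : ℝ) (_ :
s ∈ Literature.Analysis.FluidPDE.collisionTimes G ε (γ z) ∩ Set.Icc 0 τ), ∑ i : Fin (N + 1), ∑ j :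
Fin (N + 1), (if i ≠ j ∧ ‖G.sepVec (γ z s i).1 (γ z s j).1‖ = ε then F z s i j else 0); let pv :
Literature.Analysis.FluidPDE.Config (N + 1) (Fin 3) Literature.MathematicalPhysics.KineticTheory.T3
→ ℝ → Fin (N + 1) → Fin (N + 1) → Literature.MathematicalPhysics.KineticTheory.V3 ×
Literature.MathematicalPhysics.KineticTheory.V3 := fun z s i j =>
Literature.Analysis.FluidPDE.reflectVel (G.sepVec (γ z s i).1 (γ z s j).1) ((γ z s i).2, (γ z s
j).2); let D := fun z : Literature.Analysis.FluidPDE.Config (N + 1) (Fin 3)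
Literature.MathematicalPhysics.KineticTheory.T3 => Kc (fun z s i j => χ (s, (γ z s i).1) * Ψ (ε⁻¹ •
G.sepVec (γ z s i).1 (γ z s j).1, (pv z s i j).1, (pv z s i j).2) * Pm (Θ (fun _ => 1)) z s (γ z s
i).1) z - Kc (fun z s i _ => χ (s, (γ z s i).1) * Pm (Θ Ψ) z s (γ z s i).1) z;
Literature.MathematicalPhysics.KineticTheory.localGibbsLaw σ a₀ u₀ θ₀ N (Φ N) {z | η < |D z|} ≤
ENNReal.ofReal δ) ∧ (∃ η₀ : ℝ, 0 < η₀ ∧ ∀ (a₀ θ₀ : Literature.MathematicalPhysics.KineticTheory.T3 →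
ℝ) (u₀ : Literature.MathematicalPhysics.KineticTheory.T3 →
Literature.MathematicalPhysics.KineticTheory.V3), Continuous a₀ → Continuous θ₀ → Continuous u₀ → (∀
x, 0 < a₀ x) → (∀ x, 0 < θ₀ x) → ∃ σ₀ : ℝ, 0 < σ₀ ∧ ∀ σ : ℝ, 0 < σ → σ < σ₀ → ∀ Φ : (N : ℕ) →
Literature.Analysis.FluidPDE.HardSphereFlow (Literature.Analysis.FluidPDE.Torus.geometry (Fin 3))
(Literature.MathematicalPhysics.KineticTheory.hsDiameter σ N) (N + 1), ∀ τ : ℝ, 0 < τ → ∀ χ : ℝ ×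
Literature.MathematicalPhysics.KineticTheory.T3 → ℝ, Continuous χ → ∀ g : ℝ → ℝ, Continuous g → (∀
a, η₀ ≤ a → g a = 0) → ∀ η δ : ℝ, 0 < η → 0 < δ → ∃ r₀ : ℝ, 0 < r₀ ∧ ∀ r : ℝ, 0 < r → r < r₀ → ∃ N₀
: ℕ, ∀ N : ℕ, N₀ ≤ N → let ε := Literature.MathematicalPhysics.KineticTheory.hsDiameter σ N; let G :
Literature.Analysis.FluidPDE.Geometry (Fin 3) Literature.MathematicalPhysics.KineticTheory.T3 :=
Literature.Analysis.FluidPDE.Torus.geometry (Fin 3); let γ : Literature.Analysis.FluidPDE.Config (N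
+ 1) (Fin 3) Literature.MathematicalPhysics.KineticTheory.T3 → ℝ →
Literature.Analysis.FluidPDE.Config (N + 1) (Fin 3) Literature.MathematicalPhysics.KineticTheory.T3
:= fun z s => (Φ N).flow s z; let bx : Literature.MathematicalPhysics.KineticTheory.T3 →
Literature.MathematicalPhysics.KineticTheory.T3 → ℝ := fun x y => 3 / (Real.pi * r ^ 3) * max (1 -
Literature.Analysis.FluidPDE.Torus.euclidDist x y / r) 0; let ρm :
Literature.Analysis.FluidPDE.Config (N + 1) (Fin 3) Literature.MathematicalPhysics.KineticTheory.T3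
→ ℝ → Literature.MathematicalPhysics.KineticTheory.T3 → ℝ := fun z s x₀ => ∫ q, bx q.1 x₀
∂(Literature.Analysis.FluidPDE.empiricalMeasure (γ z s)); let B1 :
Literature.Analysis.FluidPDE.Config (N + 1) (Fin 3) Literature.MathematicalPhysics.KineticTheory.T3
→ ℝ → Literature.MathematicalPhysics.KineticTheory.T3 → ℝ := fun z s x₀ => ∫ p, bx p.1.1 x₀ * bx
p.2.1 x₀ * (Real.pi * ‖p.1.2 - p.2.2‖) ∂((Literature.Analysis.FluidPDE.empiricalMeasure (γ z
s)).prod (Literature.Analysis.FluidPDE.empiricalMeasure (γ z s))); let Kc :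
(Literature.Analysis.FluidPDE.Config (N + 1) (Fin 3) Literature.MathematicalPhysics.KineticTheory.T3
→ ℝ → Fin (N + 1) → Fin (N + 1) → ℝ) → Literature.Analysis.FluidPDE.Config (N + 1) (Fin 3)
Literature.MathematicalPhysics.KineticTheory.T3 → ℝ := fun F z => ε / (N + 1 : ℝ) * ∑ᶠ (s : ℝ) (_ :
s ∈ Literature.Analysis.FluidPDE.collisionTimes G ε (γ z) ∩ Set.Icc 0 τ), ∑ i : Fin (N + 1), ∑ j :
Fin (N + 1), (if i ≠ j ∧ ‖G.sepVec (γ z s i).1 (γ z s j).1‖ = ε then F z s i j else 0); let Y : ℝ →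
ℝ := fun a => 3 / (2 * Real.pi) * deriv
Literature.MathematicalPhysics.KineticTheory.hsExcessFreeEnergy a; let D :
Literature.Analysis.FluidPDE.Config (N + 1) (Fin 3) Literature.MathematicalPhysics.KineticTheory.T3
→ ℝ := fun z => Kc (fun z s i _ => χ (s, (γ z s i).1) * g (σ ^ 3 * ρm z s (γ z s i).1)) z - σ ^ 3 *
∫ s in Set.Icc (0 : ℝ) τ, ∫ x : Literature.MathematicalPhysics.KineticTheory.T3, χ (s, x) * g (σ ^ 3
* ρm z s x) * Y (σ ^ 3 * ρm z s x) * B1 z s x;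
Literature.MathematicalPhysics.KineticTheory.localGibbsLaw σ a₀ u₀ θ₀ N (Φ N) {z | η < |D z|} ≤
ENNReal.ofReal δ) ∧ (∀ (a₀ θ₀ : Literature.MathematicalPhysics.KineticTheory.T3 → ℝ) (u₀ :
Literature.MathematicalPhysics.KineticTheory.T3 → Literature.MathematicalPhysics.KineticTheory.V3),
Continuous a₀ → Continuous θ₀ → Continuous u₀ → (∀ x, 0 < a₀ x) → (∀ x, 0 < θ₀ x) → ∃ σ₀ : ℝ, 0 < σ₀
∧ ∀ σ : ℝ, 0 < σ → σ < σ₀ → ∀ (T : ℝ) (ρ θ : ℝ → Literature.MathematicalPhysics.KineticTheory.T3 →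
ℝ) (u : ℝ → Literature.MathematicalPhysics.KineticTheory.T3 →
Literature.MathematicalPhysics.KineticTheory.V3),
Literature.MathematicalPhysics.KineticTheory.IsHardSphereEulerSolution σ T ρ u θ → ∀ Φ : (N : ℕ) →
Literature.Analysis.FluidPDE.HardSphereFlow (Literature.Analysis.FluidPDE.Torus.geometry (Fin 3))
(Literature.MathematicalPhysics.KineticTheory.hsDiameter σ N) (N + 1),
Literature.MathematicalPhysics.KineticTheory.TendstoHydroFieldsAt (fun N =>
Literature.MathematicalPhysics.KineticTheory.localGibbsLaw σ a₀ u₀ θ₀ N (Φ N)) Φ ρ u θ 0 → 0 < T → ∀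
τ : ℝ, 0 < τ → ∀ φ : ℝ → Literature.MathematicalPhysics.KineticTheory.T3 → ℝ,
Literature.Analysis.FunctionSpaces.Torus.IsSmoothSpaceTimeOn Set.univ φ → (∀ s x, 0 ≤ φ s x) → (∃ τ'
: ℝ, τ' < τ ∧ ∀ s, τ' ≤ s → ∀ x, φ s x = 0) → ∀ η δ : ℝ, 0 < η → 0 < δ → ∃ r₀ : ℝ, 0 < r₀ ∧ ∀ r : ℝ,
0 < r → r < r₀ → ∃ N₀ : ℕ, ∀ N : ℕ, N₀ ≤ N → let γ : Literature.Analysis.FluidPDE.Config (N + 1)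
(Fin 3) Literature.MathematicalPhysics.KineticTheory.T3 → ℝ → Literature.Analysis.FluidPDE.Config (N
+ 1) (Fin 3) Literature.MathematicalPhysics.KineticTheory.T3 := fun z s => (Φ N).flow s z; let bx :
Literature.MathematicalPhysics.KineticTheory.T3 → Literature.MathematicalPhysics.KineticTheory.T3 →
ℝ := fun x y => 3 / (Real.pi * r ^ 3) * max (1 - Literature.Analysis.FluidPDE.Torus.euclidDist x y /
r) 0; let ρm : Literature.Analysis.FluidPDE.Config (N + 1) (Fin 3)
Literature.MathematicalPhysics.KineticTheory.T3 → ℝ →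
Literature.MathematicalPhysics.KineticTheory.T3 → ℝ := fun z s x₀ => ∫ q, bx q.1 x₀
∂(Literature.Analysis.FluidPDE.empiricalMeasure (γ z s)); let mm :
Literature.Analysis.FluidPDE.Config (N + 1) (Fin 3) Literature.MathematicalPhysics.KineticTheory.T3
→ ℝ → Literature.MathematicalPhysics.KineticTheory.T3 →
Literature.MathematicalPhysics.KineticTheory.V3 := fun z s x₀ => ∫ q, bx q.1 x₀ • q.2
∂(Literature.Analysis.FluidPDE.empiricalMeasure (γ z s)); let em :
Literature.Analysis.FluidPDE.Config (N + 1) (Fin 3) Literature.MathematicalPhysics.KineticTheory.T3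
→ ℝ → Literature.MathematicalPhysics.KineticTheory.T3 → ℝ := fun z s x₀ => ∫ q, bx q.1 x₀ * (‖q.2‖ ^
2 / 2) ∂(Literature.Analysis.FluidPDE.empiricalMeasure (γ z s)); let θm :
Literature.Analysis.FluidPDE.Config (N + 1) (Fin 3) Literature.MathematicalPhysics.KineticTheory.T3
→ ℝ → Literature.MathematicalPhysics.KineticTheory.T3 → ℝ := fun z s x₀ => 2 / 3 * (em z s x₀ / ρm z
s x₀ - ‖mm z s x₀‖ ^ 2 / (2 * ρm z s x₀ ^ 2)); let Hs : ℝ → ℝ → ℝ := fun a b => if 0 < a ∧ 0 < b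
then -(a * (3 / 2 * Real.log b - Real.log a -
Literature.MathematicalPhysics.KineticTheory.hsExcessFreeEnergy (a * σ ^ 3))) else 0; let I :
Literature.Analysis.FluidPDE.Config (N + 1) (Fin 3) Literature.MathematicalPhysics.KineticTheory.T3
→ ℝ := fun z => ∫ s in Set.Icc (0 : ℝ) τ, ∫ x : Literature.MathematicalPhysics.KineticTheory.T3, Hs
(ρm z s x) (θm z s x) * (deriv (fun s' => φ s' x) s + ∑ k : Fin 3, (mm z s x) k / ρm z s x *
Literature.Analysis.FunctionSpaces.Torus.partialDeriv k (φ s) x);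
Literature.MathematicalPhysics.KineticTheory.localGibbsLaw σ a₀ u₀ θ₀ N (Φ N) {z | I z + ∫ x :
Literature.MathematicalPhysics.KineticTheory.T3, Hs (ρ 0 x) (θ 0 x) * φ 0 x < -η} ≤ ENNReal.ofReal
δ) ∧ (∀ (a₀ θ₀ : Literature.MathematicalPhysics.KineticTheory.T3 → ℝ) (u₀ :
Literature.MathematicalPhysics.KineticTheory.T3 → Literature.MathematicalPhysics.KineticTheory.V3),
Continuous a₀ → Continuous θ₀ → Continuous u₀ → (∀ x, 0 < a₀ x) → (∀ x, 0 < θ₀ x) → ∃ σ₀ : ℝ, 0 < σ₀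
∧ ∀ σ : ℝ, 0 < σ → σ < σ₀ → ∀ (T : ℝ) (ρ θ : ℝ → Literature.MathematicalPhysics.KineticTheory.T3 →
ℝ) (u : ℝ → Literature.MathematicalPhysics.KineticTheory.T3 →
Literature.MathematicalPhysics.KineticTheory.V3),
Literature.MathematicalPhysics.KineticTheory.IsHardSphereEulerSolution σ T ρ u θ → ∀ Φ : (N : ℕ) →
Literature.Analysis.FluidPDE.HardSphereFlow (Literature.Analysis.FluidPDE.Torus.geometry (Fin 3))
(Literature.MathematicalPhysics.KineticTheory.hsDiameter σ N) (N + 1),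
Literature.MathematicalPhysics.KineticTheory.TendstoHydroFieldsAt (fun N =>
Literature.MathematicalPhysics.KineticTheory.localGibbsLaw σ a₀ u₀ θ₀ N (Φ N)) Φ ρ u θ 0 → ∀ t ∈
Set.Ico 0 T, ∀ η δ : ℝ, 0 < η → 0 < δ → ∃ r₀ : ℝ, 0 < r₀ ∧ ∀ r : ℝ, 0 < r → r < r₀ → ∃ N₀ : ℕ, ∀ N :
ℕ, N₀ ≤ N → let γ : Literature.Analysis.FluidPDE.Config (N + 1) (Fin 3)
Literature.MathematicalPhysics.KineticTheory.T3 → ℝ → Literature.Analysis.FluidPDE.Config (N + 1)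
(Fin 3) Literature.MathematicalPhysics.KineticTheory.T3 := fun z s => (Φ N).flow s z; let bx :
Literature.MathematicalPhysics.KineticTheory.T3 → Literature.MathematicalPhysics.KineticTheory.T3 →
ℝ := fun x y => 3 / (Real.pi * r ^ 3) * max (1 - Literature.Analysis.FluidPDE.Torus.euclidDist x y /
r) 0; let ρm : Literature.Analysis.FluidPDE.Config (N + 1) (Fin 3)
Literature.MathematicalPhysics.KineticTheory.T3 → ℝ →
Literature.MathematicalPhysics.KineticTheory.T3 → ℝ := fun z s x₀ => ∫ q, bx q.1 x₀
∂(Literature.Analysis.FluidPDE.empiricalMeasure (γ z s));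
Literature.MathematicalPhysics.KineticTheory.localGibbsLaw σ a₀ u₀ θ₀ N (Φ N) {z | ∃ s ∈ Set.Icc 0
t, ∃ x : Literature.MathematicalPhysics.KineticTheory.T3, ρ s x + η < ρm z s x} ≤ ENNReal.ofReal δ)`

## Assembly
Standard reductions, all on the prover of the assembly item (heavy but classical): (i) tightness of
(μ^N, κ^N) as random measures on [0,τ]×𝕋³×ℝ³ resp. [0,τ]×𝕋³×ℝ³×ℝ³×ℝ³ (energy conservation +
CollisionTightness), Skorokhod subsequences; (ii) EmpiricalEnskogIdentity ÷ ν_N ⇒ collisional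
balance of κ̄_{t,x} for all bounded continuous φ; undivided, with φ ∈ {1, v, |v|²} ⇒ the five
conservation laws with kinetic fluxes ⟨μ̄, v⊗v⟩ (concentration defect dominated by the exact global
energy) and collisional-transfer fluxes = explicit σ-moments of κ̄; (iii) ContactChaos ⇒ product
structure, BalanceRigidity ⇒ μ̄_{t,x} = ρ̄ M_{ū,θ̄} or a point mass; CollisionRate (+
HsEosLowDensity) ⇒ λ = σ³Y(σ³ρ̄) on {σ³ρ̄ < η₀}, hence p = hsPressure and zero heat flux there;
DensityCap ⇒ that set is everything for t < T (σ₀ chosen so that 2σ³ sup ρ < η₀ is NOT available —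
σ₀ precedes T in the conjunct; the prover uses DensityCap with the pointwise Euler density and the
cutoff at η₀ only where ρσ³ < η₀/2, and must treat data whose classical solution leaves {ρσ³ < η₀/2}
as the statement-level hazard recorded under Kill criteria); (iv) LocalSecondLaw + exact global
energy ⇒ the limit is a dissipative (measure-valued in the BF2018 sense, Maxwellian-closed) solution
of the complete hs-Euler system with the classical initial data; Březina–Feireisl / Feireisl–Novotný
relative energy (HsEntropyConvex, stmt-0817, is its structural input; stmt-0825 the PDE theorem) ⇒
it equals the classical solution on [0,T) almost surely ⇒ full-sequence convergence in probability
of the fields ⇒ HydrodynamicLimitFor σ ⇒ the conjunct via hydrodynamicLimit_of_forall.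

Rationale: WHY THIS LINE. The exact identity for the pair (empirical measure, empirical collision measure) of a
hard-sphere trajectory (Bogolyubov1975; Pulvirenti–Simonella
arXiv:1504.03215; PulvirentiSimonellaTrushechkin2018) has so far only fed Boltzmann–Grad validity
(Lanford1975, CercignaniIllnerPulvirenti1994,
PulvirentiSimonella2016, BGSSAnnals2023), where chaos must be PROPAGATED; at FIXED density ν_N → ∞
makes the leading order of the identity the
statement "Q = 0" for the LIMIT kernel, so the compactness + moment-method architecture of kinetic
hydrodynamic limits (SaintRaymond2009 Ch. 6,
Villani2002 Ch. 1 §2; Lions–Perthame–Tadmor kinetic formulations as template) applies to N-body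
collision statistics with no kinetic equation
ever derived, and everything beyond product structure of κ̄ and locality of its rate is classical
rigidity (LuMouhot2015 for measures) plus
hyperbolic weak–strong uniqueness (Dafermos1979, FeireislNovotny2012, BrezinaFeireisl2018). Imported
areas: kinetic theory of measure solutions,
Young-measure/compensated-compactness bookkeeping, relative-entropy stability of hyperbolic systems.
Versus prior routes: DissipativeWeakStrong
puts the Young measure on STATE space (ρ, m, E) and asks FluxClosure (stmt-0823, informal); here it
sits on velocity/collision space where
balance is free and Boltzmann's rigidity does the identification;
DenseKineticExpansion/ChapmanEnskogCorrector estimate marginals of the law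
f_t, here no marginal is touched; RelEntropyErgodic/ChaoticMixing need ergodic inputs on the N-body
law. Planner's correction of the card:
weak–strong uniqueness for the COMPLETE Euler system with unbounded weak solutions consumes the
LOCAL entropy inequality (or L^∞ caps), not the
free global one, so the card's crux 3 (cubic UI) is replaced by LocalSecondLaw + DensityCap and the
energy enters only globally (exact).

RANKED CRUXES. #2 ContactChaos (crux) — AVERAGED MOLECULAR CHAOS AT CONTACT FOR THE LIMIT (card crux
1). For σ < σ₀(profiles), local Gibbs data, every horizon τ, every continuous space-time localiser χ
and bounded continuous mark test Ψ(ω, v, v*): the cross-ratio defect D_N = K_N[χ·Ψ·A_r] −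
K_N[χ·B^Ψ_r] → 0 in probability as N → ∞ then r → 0, where K_N[F] = (ε/(N+1)) Σ_{collisions s ≤ τ,
ordered contact pairs (i,j)} F evaluated at (s, x_i, ω = (x_i−x_j)/ε, pre-collisional (v_i, v_j) =
reflectVel), and A_r, B^Ψ_r are the r-mollified empirical pair fields ∫∫ Θ(v,w) μ^N_s⊗μ^N_s near (s,
x) with Θ_1 = ∫((v−w)·ω)₋dω and Θ_Ψ = ∫Ψ(ω,v,w)((v−w)·ω)₋dω. In the limit this says
κ̄_{t,x}(Ψ)·⟨μ̄⊗μ̄, Θ_1⟩ = κ̄_{t,x}(1)·⟨μ̄⊗μ̄, Θ_Ψ⟩ a.e., i.e. κ̄_{t,x} = λ(t,x)((v−v*)·ω)₋ dω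
μ̄_{t,x}(dv) μ̄_{t,x}(dv*) with the rate λ free. [difficulty: open-problem] (why it might fail:
persistent pre-collisional velocity correlations at positive density (rings/caging; shear-induced
contact anisotropy is real at finite Kn, Lutsko1996) — bet: O(Kn)=O(N^{-1/3}) after space-time
averaging; no rigorous handle on non-equilibrium contact statistics of deterministic spheres
exists.) [Bogolyubov1975, arXiv:1504.03215, PulvirentiSimonellaTrushechkin2018, Lutsko1996,
Rezakhanlou2003, VanbeijerenErnst1973, Resibois1978]
#3 CollisionRate (crux) — RATE / CONTACT-VALUE IDENTIFICATION (card crux 2, Enskog form B). There is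
a universal η₀ > 0 such that for σ < σ₀(profiles), local Gibbs data, every τ, χ and every continuous
cutoff g vanishing on [η₀, ∞): K_N[χ·g(σ³ρ^N_r)] − σ³ ∫_0^τ∫_{𝕋³} χ g(σ³ρ^N_r) Y(σ³ρ^N_r) B¹_r dx ds
→ 0 in probability (N → ∞ then r → 0), with ρ^N_r the r-mollified empirical density, B¹_r = ∫∫
π|v−w| (mollified μ^N_s⊗μ^N_s) and Y(η) = (3/2π)·deriv hsExcessFreeEnergy η the thermodynamic
contact value ((Z−1)/((2π/3)η)). In the limit: κ̄_{t,x}(1) = σ³ Y(σ³ρ̄) π∫∫|v−w| μ̄_{t,x} μ̄_{t,x}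
wherever σ³ρ̄ < η₀ — the Enskog collision frequency, which with ContactChaos and Maxwellian μ̄
yields p = hsPressure σ ρ θ exactly (kinetic ρθ + collisional transfer (2π/3)σ³Yρ²θ). [deps:
ContactChaos] [difficulty: open-problem] (why it might fail: a history-dependent collision rate (λ
not a function of the instantaneous local density) or a dynamical contact value ≠ thermodynamic Y
out of equilibrium — conceivable exactly where ContactChaos fails; beyond the fluid branch Y from
hsExcessFreeEnergy is not the contact value (hence the cutoff η₀).) [VanbeijerenErnst1973,
Resibois1978, Lachowicz1998, Ruelle1969, LebowitzPenrose1964]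
#4 LocalSecondLaw (crux) — LOCAL ENTROPY INEQUALITY IN PROBABILITY for the r-mollified empirical
fields (ρ, m, e)^N_r with θ = (2/3)(e/ρ − |m|²/2ρ²) and mathematical entropy H(ρ,θ) = −ρ(3/2 log θ −
log ρ − hsExcessFreeEnergy(ρσ³)): for every smooth φ ≥ 0 supported in [0,τ) × 𝕋³, P(∫∫ H (∂_sφ +
(m/ρ)·∇φ) dx ds + ∫ H(ρ(0),θ(0)) φ(0) dx < −η) → 0 as N → ∞ then r → 0, under the conjunct's
hypotheses (Euler data (ρ,u,θ)(0) = limits of the local Gibbs fields). This is the admissibility the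
Feireisl–Novotný / Březina–Feireisl relative-energy method consumes for the COMPLETE Euler system
(energy only globally, exact here); the GLOBAL Clausius inequality in expectation is free (Liouville
+ Gibbs variational bound), the local one is not. [difficulty: open-problem] (why it might fail: at
Euler scaling the leading entropy production vanishes by free balance; the local sign is that of the
O(Kn) deviation of κ^N from product structure (Navier–Stokes-order dissipation) — physically ≥ 0,
but no in-probability local second law is known for deterministic spheres.) [FeireislNovotny2012,
BrezinaFeireisl2018, Resibois1978, OllaVaradhanYau1993, Spohn1991]
#5 DensityCap (crux) — NO OVERCOMPRESSION BEFORE THE SHOCK: under the conjunct's hypotheses, for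
every t < T and η > 0, P(∃ s ≤ t, ∃ x: ρ^N_r(s,x) > ρ(s,x) + η) → 0 as N → ∞ then r → 0 (ρ = the
classical Euler density). Needed because on sets of reduced density ≥ η₀ the collisional fluxes are
neither identified (CollisionRate is cut off) nor a priori bounded (contact values blow up toward
close packing), so they cannot be absorbed in the relative-energy Gronwall; at each FIXED scale r a
scale-dependent cap is free by entropy transfer against the invariant Gibbs law, the scale-uniform
one-sided bound is not. [difficulty: L] (why it might fail: transient mesoscopic pre-crystalline
clusters ahead of steepening compressive waves; there is no maximum principle for the empirical
density of the particle system, and for implosion-type data the Euler density itself leaves the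
fluid branch near T (statement-level hazard shared by all routes).) [Spohn1991, OllaVaradhanYau1993,
Ruelle1969]
#9 CollisionTightness (support) — tightness of the normalised collision count (card S1): for σ <
σ₀(profiles), every τ and δ there are K, N₀ with P((ε/(N+1))·#collisions in [0,τ] > K) ≤ δ for N ≥
N₀ (ε = hsDiameter σ N; #collisions = FP.numCollisions of the flow trajectory). Expected proof:
Cauchy–Schwarz transfer of an equilibrium large-deviation bound for excess collision counts from the
invariant canonical Gibbs law (card spacetime-superextensive-ld); not routine (super-extensive count
N^{4/3}). [difficulty: M] [arXiv:1504.03215, GST2013, Spohn1991]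
#9 BalanceRigidity (support) — Boltzmann's uniqueness of collision equilibria, MEASURE version (card
S3): a finite Borel measure m on ℝ³ with finite second moment whose product kernel is collisionally
balanced, ∫∫∫ ((v−w)·ω)₊ [φ(v′)+φ(w′)−φ(v)−φ(w)] dω m(dv) m(dw) = 0 for all bounded continuous φ, is
a (possibly zero) point mass or ρ·Maxwellian(θ,u)·Lebesgue with ρ, θ > 0. [difficulty: M]
[LuMouhot2015, CercignaniIllnerPulvirenti1994, Villani2002]
#9 EmpiricalEnskogIdentity (support) — the EXACT IDENTITY for empirical measures along one
trajectory (card S2; Bogolyubov's microscopic Enskog equation, torus version): for every hard-sphere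
flow Φ on 𝕋³ (any ε > 0, N), every good z, τ > 0, a ∈ C¹(ℝ), smooth b on 𝕋³ and any c on ℝ³:
a(τ)⟨μ_τ, b c⟩ − a(0)⟨μ_0, b c⟩ − ∫_0^τ [a′⟨μ_s, b c⟩ + a⟨μ_s, (v·∇b) c⟩] ds = N⁻¹ Σ_{collision
times s ∈ (0,τ]} a(s) Σ_{ordered contact pairs (i,j)} b(x_i)[c(v_i) − c((reflectVel (x_i−x_j)
(v_i,v_j)).1)] (μ_s = empiricalMeasure of Φ_s z; right-continuous trajectories, pre-collisional
velocities by the involution reflectVel). [difficulty: provable-now] [Bogolyubov1975,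
arXiv:1504.03215, GST2013]
#9 HsEosLowDensity (support) — hard-sphere equation of state at low density (shared item
stmt-AtomisticToContinuum-0768, re-attached): f_ex = hsExcessFreeEnergy is real-analytic on [0, η₀)
with f_ex(0) = 0, f_ex′(0) = 2π/3 and the canonical thermodynamic limit exists; makes Y = (3/2π)
f_ex′ continuous with Y(0) = 1 and hsPressure smooth (needed by CollisionRate and by the PDE step).
[difficulty: L] [Ruelle1969, LebowitzPenrose1964]

TWO-LAYER PLAN. Foreseen once something closes (nothing filed now): ContactChaos ⇐
EquilibriumContactLLN (κ^N under the invariant canonical Gibbs law converges to the Enskog kernel: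
stationarity + Santaló/Chernov mean-free-path identity + spatial decorrelation) →
NonequilibriumTransfer (the product-structure defect is priced super-extensively under G and
transferred to f_t; engine of card spacetime-superextensive-ld) → ContactChaos. Assembly ⇐
LimitPairExists (tightness + identification of subsequential limits as Maxwellian-closed dissipative
solutions) → HsEulerWeakStrong (BF2018 for the hs EOS, = stmt-0825 typed) → Assembly. LocalSecondLaw
⇐ renormalised version with bounded χ(s) if the PDE step demands it.

KILL CRITERIA. A subsequential limit of κ^N whose (t,x)-disintegration is NOT of product form for
some smooth pre-shock local Gibbs datum at arbitrarily small σ (e.g. an N^0 shear-induced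
pre-collisional correlation surviving space-time averaging) refutes ContactChaos and closes the
route (refuted:ContactChaos); it would also kill FluxClosure (0823) and strongly suggest
¬HydrodynamicLimit — file ¬HydrodynamicLimitFor then. ¬CollisionRate with ContactChaos intact ⇒
pivot to the thermodynamic form (λ = Λ(ρ,θ) for SOME continuous Λ + EOS rigidity from the free
second law, card invariant-gibbs-entropy-bookkeeping (v)). ¬LocalSecondLaw ⇒ pivot to L^∞ caps +
Dafermos1979 with the local energy law (then cubic UI, card apriori-tails-and-rattlers, returns as a
crux). ¬DensityCap can only come with ¬HydrodynamicLimit. Implosion-type data whose classical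
solution leaves the fluid branch before T are a statement-level hazard shared by every route (card
implosion-loophole), not a kill of this line. RelEntropyVanishing (0766) or L2HydroFields (0800)
proved elsewhere moots the route.

NOT DECOMPOSED YET. The equilibrium LLN for κ^N and the transfer step (children of ContactChaos);
the renormalised entropy inequality; velocity-moment bookkeeping for the momentum-flux concentration
defect; the typed BF2018 theorem for the hs EOS (lives with DissipativeWeakStrong's 0825/0817); the
passage subsequence → full sequence; constants η₀ (EOS analyticity radius) and the mollifier shapes
(tents) — all layer-2 or prover-level.

CHEAPEST FALSIFIER. Event-driven MD of ~10⁵ hard spheres at packing fraction 0.05–0.2 in a smooth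
shear or compression profile: histogram pre-collisional pair marks (ω·(v−v*), ∠(v,v*), |v|, |v*|) in
space-time bins and test the cross-ratio identity of ContactChaos against the local one-particle
histogram, and the collision frequency against σ³Y(σ³ρ)π⟨|v−w|⟩; a non-factorising residual that
does not shrink like N^{-1/3} kills the line. Analytic proxy: the first ring/shear correction to the
contact pair correlation in uniform shear flow is O(shear rate × mean free time) (Lutsko1996), i.e.
O(Kn) — consistent, not a kill. Not run here (no kit in plancard mode).

NUMBERS. ν_N ≍ σ²(N+1)^{1/3} collisions per particle per unit time; normalisation ε_N/(N+1) makes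
κ^N([0,τ]) = O(σ³τ); Y(0) = 1, Y(η) = 1 + (5π/12)η + O(η²) (third virial), Z = 1 + (2π/3)ηY;
hard-sphere freezing at packing fraction ≈ 0.494 (η = ρd³ ≈ 0.943) bounds the fluid branch; items at
open: 9 (4 cruxes, 4 supports, 1 assembly).

DEFINITION REQUESTS. `empiricalCollisionMeasure` (Literature/Analysis/FluidPDE): the marked point
measure (ε/(N+1))·Σ_{s ∈ collisionTimes ∩ [0,τ]} Σ_{ordered contact pairs} δ_{(s, x_i, (x_i−x_j)/ε,
reflectVel-pre-velocities)} of a HardSphereFlow trajectory as a `Measure (ℝ × T3 × V3 × V3 × V3)`,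
with the finsum/contact-pair API used inline in ContactChaos/CollisionRate/EmpiricalEnskogIdentity
factored out (would shorten every signature of this route). Young-measure disintegration on [0,τ]×𝕋³
is NOT requested: the route is typed mollifier-wise.

Novelty: Searches (2026-08-15): `lit frontier AtomisticToContinuum --since 2020` (30 rows: DHM-programme
descendants, CanestrariLiveraniOlla2026; nothing on collision measures at fixed density); `lit
bridges AtomisticToContinuum --cross any` (30 rows; weak–strong-uniqueness bridge
doi:10.1007/s00205-019-01486-2 noted); `lit search --source crossref "empirical collision measure
hard spheres hydrodynamic limit molecular chaos contact Enskog Euler"` (6: Lampis–Petrina 1997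
Boltzmann–Enskog limit of EQUILIBRIUM states doi:10.1007/bf02487342, Trushechkin 2014
doi:10.3934/krm.2014.7.755, Lutsko1996); `lit search --source zbmath/s2 "measure solutions Boltzmann
equation hard potentials equilibrium Maxwellian"` (LuMouhot2015 arXiv:1306.0764); `lit search
--source zbmath "weak-strong uniqueness complete Euler system measure-valued solutions entropy"` (4:
BrezinaFeireisl2018, arXiv:1710.10751, arXiv:1904.00622, arXiv:1805.05570); the card's own
crossref/zbMATH sweep (Bogolyubov1975, arXiv:1504.03215, PulvirentiSimonellaTrushechkin2018) and the
refuter novelty audit of the card (2026-08-15, grade new-combination). Local `lit search --hybrid`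
daemon unavailable during this session (connection reset) — remote tiers used.
Nearest prior art found: Bogolyubov1975 / arXiv:1504.03215 (the exact empirical-measure Enskog
identity, used toward microscopic Enskog solutions and Boltzmann–Grad validity only);
Rezakhanlou2003 (kinetic limits with factorised contact statistics for STOCHASTIC hard-sphere
models)  [refs: 10.1007/s00205-019-01486-2, 10.1007/bf02487342, 10.3934/krm.2014.7.755, 1306.0764, 1710.10751, 1904.00622, 1805.05570, 1504.03215, doi:10.1007/s00205-019-01486-2, doi:10.1007/bf02487342, doi:10.3934/krm.2014.7.755, CanestrariLiveraniOlla2026, Lutsko1996, LuMouhot2015, BrezinaFeireisl2018, Bogolyubov1975, PulvirentiSimonellaTrushechkin2018, Rezakhanlou2003, SaintRaymond2009]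

Barriers (technique_class: limit-collision-measure, kinetic-formulation, young-measure): - technique_class: limit-collision-measure, kinetic-formulation, young-measure
- Literature.Barriers.AtomisticToContinuum.DiluteRegimeBarrier: evaded — no Boltzmann–Grad limit and
no kinetic equation for f^{(1)}; (N+1)ε³ = σ³ fixed, the Enskog structure enters only through the
exact finite-N identity, and the EOS is the full hsPressure (collisional transfer survives because
ε_N ν_N = O(σ³)), so its ideal-gas trap cannot occur.
- Literature.Barriers.AtomisticToContinuum.NoDensityExpansionBarrier: not met — nothing is expanded
in density or resummed; its ring-collision physics is exactly the "why ContactChaos might fail" and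
is bet to be O(Kn) at Euler order after space-time averaging, never summed.
- Literature.Barriers.AtomisticToContinuum.BoltzmannHypothesisBarrier: outside its technique class
(no classification of stationary states of the infinite system, no one-block replacement; cf.
BoltzmannHypothesisBarrierNarrow scope (c)); in substance ContactChaos IS a local-equilibrium input,
but for the smallest carrier (an (ω,v,v*)-kernel per macroscopic point), and it is vacuous — hence
useless — exactly on the barrier's kernels (ideal gas: κ̄ = 0; d = 1 rods: balance is an identity),
consistent with the catalogue.
- Literature.Barriers.AtomisticToContinuum.HighMomentumCutoffBarrier: sidestepped rather than met —
the energy equation is used only GLOBALLY (exact conservation), momentum-flux concentration is a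
defect dominated by it (BF2018 framework); the price is LocalSecondLaw.

History (route lifecycle, newest last):
- 2026-08-15T13:41:18Z · CLOSED retired — not-a-thesis: assembly does not conclude the sub-problem Statement (operator:999:1257524)

sub-problem: HydrodynamicLimit · status: closed(retired) · opened planner-plancard-AtomisticToContinuum-Hydrody-0bcf4f2a-0 2026-08-15T11:26:53Z · rev 0 · ledger route-AtomisticToContinuum-CollisionMeasureChaos
GENERATED by the gate from the ledger (D-0016/17). Provers cite these decls: `theorem foo : Summit.AtomisticToContinuum.HydrodynamicLimit.Theses.CollisionMeasureChaos.<Decl> := …` in Summits/AtomisticToContinuum/HydrodynamicLimit/Theorems/<Name>.lean.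
-/

namespace Summit.AtomisticToContinuum.HydrodynamicLimit.Theses.CollisionMeasureChaos

open scoped BigOperators Topology Manifold Classical MeasureTheory ProbabilityTheory Matrix InnerProductSpace ComplexConjugate ContinuousMap
open Filter Set Function TopologicalSpace MeasureTheory

attribute [summit_statement] _root_.HydrodynamicLimit

/-- item stmt-AtomisticToContinuum-3987 · crux · rank 2 · closed · moot by None · by planner
why it might fail: persistent pre-collisional velocity correlations at positive density (rings/caging; shear-induced contact anisotropy is real at finite Kn, Lutsko1996) — bet: O(Kn)=O(N^{-1/3}) after space-time averaging; no rigorous handle on non-equilibrium contact statistics of deterministic spheres exists.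
sources: Bogolyubov1975, arXiv:1504.03215, PulvirentiSimonellaTrushechkin2018, Lutsko1996, Rezakhanlou2003, VanbeijerenErnst1973
[crux] AVERAGED MOLECULAR CHAOS AT CONTACT FOR THE LIMIT (card crux 1). For σ < σ₀(profiles), local
Gibbs data, every horizon τ, every continuous space-time localiser χ and bounded continuous mark
test Ψ(ω, v, v*): the cross-ratio defect D_N = K_N[χ·Ψ·A_r] − K_N[χ·B^Ψ_r] → 0 in probability as N →
∞ then r → 0, where K_N[F] = (ε/(N+1)) Σ_{collisions s ≤ τ, ordered contact pairs (i,j)} F evaluated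
at (s, x_i, ω = (x_i−x_j)/ε, pre-collisional (v_i, v_j) = reflectVel), and A_r, B^Ψ_r are the
r-mollified empirical pair fields ∫∫ Θ(v,w) μ^N_s⊗μ^N_s near (s, x) with Θ_1 = ∫((v−w)·ω)₋dω and Θ_Ψ
= ∫Ψ(ω,v,w)((v−w)·ω)₋dω. In the limit this says κ̄_{t,x}(Ψ)·⟨μ̄⊗μ̄, Θ_1⟩ = κ̄_{t,x}(1)·⟨μ̄⊗μ̄, Θ_Ψ⟩
a.e., i.e. κ̄_{t,x} = λ(t,x)((v−v*)·ω)₋ dω μ̄_{t,x}(dv) μ̄_{t,x}(dv*) with the rate λ free.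
[difficulty: open-problem] -/
@[route_item "route-AtomisticToContinuum-CollisionMeasureChaos"]
def ContactChaos : Prop :=
  ∀ (a₀ θ₀ : Literature.MathematicalPhysics.KineticTheory.T3 → ℝ) (u₀ : Literature.MathematicalPhysics.KineticTheory.T3 → Literature.MathematicalPhysics.KineticTheory.V3), Continuous a₀ → Continuous θ₀ → Continuous u₀ → (∀ x, 0 < a₀ x) → (∀ x, 0 < θ₀ x) → ∃ σ₀ : ℝ, 0 < σ₀ ∧ ∀ σ : ℝ, 0 < σ → σ < σ₀ → ∀ Φ : (N : ℕ) → Literature.Analysis.FluidPDE.HardSphereFlow (Literature.Analysis.FluidPDE.Torus.geometry (Fin 3)) (Literature.MathematicalPhysics.KineticTheory.hsDiameter σ N) (N + 1), ∀ τ : ℝ, 0 < τ → ∀ χ : ℝ × Literature.MathematicalPhysics.KineticTheory.T3 → ℝ, Continuous χ → ∀ Ψ : Literature.MathematicalPhysics.KineticTheory.V3 × Literature.MathematicalPhysics.KineticTheory.V3 × Literature.MathematicalPhysics.KineticTheory.V3 → ℝ, Continuous Ψ → (∃ C : ℝ, ∀ p, |Ψ p| ≤ C) → ∀ η δ : ℝ,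 0 < η → 0 < δ → ∃ r₀ : ℝ, 0 < r₀ ∧ ∀ r : ℝ, 0 < r → r < r₀ → ∃ N₀ : ℕ, ∀ N : ℕ, N₀ ≤ N → let ε := Literature.MathematicalPhysics.KineticTheory.hsDiameter σ N; let G : Literature.Analysis.FluidPDE.Geometry (Fin 3) Literature.MathematicalPhysics.KineticTheory.T3 := Literature.Analysis.FluidPDE.Torus.geometry (Fin 3); let γ : Literature.Analysis.FluidPDE.Config (N + 1) (Fin 3) Literature.MathematicalPhysics.KineticTheory.T3 → ℝ → Literature.Analysis.FluidPDE.Config (N + 1) (Fin 3) Literature.MathematicalPhysics.KineticTheory.T3 := fun z s => (Φ N).flow s z; let bx : Literature.MathematicalPhysics.KineticTheory.T3 → Literature.MathematicalPhysics.KineticTheory.T3 → ℝ := fun x y => 3 / (Real.pi * r ^ 3) * max (1 - Literature.Analysis.FluidPDE.Torus.euclidDist x y / r) 0; let bt : ℝ → ℝ := fun a => r⁻¹ * max (1 - |a| / r) 0; let Θ := fun (Ξ : Literature.MathematicalPhysics.KineticTheory.V3 × Literature.MathematicalPhysics.KineticTheory.V3 × Literature.MathematicalPhysics.KineticTheory.V3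 → ℝ) (v w : Literature.MathematicalPhysics.KineticTheory.V3) => ∫ ω : Metric.sphere (0 : Literature.MathematicalPhysics.KineticTheory.V3) 1, Ξ ((ω : Literature.MathematicalPhysics.KineticTheory.V3), v, w) * Literature.MathematicalPhysics.KineticTheory.hardSphereKernel (w, v) ω ∂Literature.MathematicalPhysics.KineticTheory.sphereMeasure; let Pm : (Literature.MathematicalPhysics.KineticTheory.V3 → Literature.MathematicalPhysics.KineticTheory.V3 → ℝ) → Literature.Analysis.FluidPDE.Config (N + 1) (Fin 3) Literature.MathematicalPhysics.KineticTheory.T3 → ℝ → Literature.MathematicalPhysics.KineticTheory.T3 → ℝ := fun Th z s₀ x₀ => ∫ s in Set.Icc (0 : ℝ) τ, bt (s - s₀) * ∫ p, bx p.1.1 x₀ * bx p.2.1 x₀ * Th p.1.2 p.2.2 ∂((Literature.Analysis.FluidPDE.empiricalMeasure (γ z s)).prod (Literature.Analysis.FluidPDE.empiricalMeasure (γ z s))); let Kc : (Literature.Analysis.FluidPDE.Config (N + 1) (Fin 3) Literature.MathematicalPhysics.KineticTheory.T3 → ℝ → Fin (N + 1) → Fin (N + 1) → ℝ) → Literature.Analysis.FluidPDE.Config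 (N + 1) (Fin 3) Literature.MathematicalPhysics.KineticTheory.T3 → ℝ := fun F z => ε / (N + 1 : ℝ) * ∑ᶠ (s : ℝ) (_ : s ∈ Literature.Analysis.FluidPDE.collisionTimes G ε (γ z) ∩ Set.Icc 0 τ), ∑ i : Fin (N + 1), ∑ j : Fin (N + 1), (if i ≠ j ∧ ‖G.sepVec (γ z s i).1 (γ z s j).1‖ = ε then F z s i j else 0); let pv : Literature.Analysis.FluidPDE.Config (N + 1) (Fin 3) Literature.MathematicalPhysics.KineticTheory.T3 → ℝ → Fin (N + 1) → Fin (N + 1) → Literature.MathematicalPhysics.KineticTheory.V3 × Literature.MathematicalPhysics.KineticTheory.V3 := fun z s i j => Literature.Analysis.FluidPDE.reflectVel (G.sepVec (γ z s i).1 (γ z s j).1) ((γ z s i).2, (γ z s j).2); let D := fun z : Literature.Analysis.FluidPDE.Config (N + 1) (Fin 3) Literature.MathematicalPhysics.KineticTheory.T3 => Kc (fun z s i j => χ (s, (γ z s i).1) * Ψ (ε⁻¹ • G.sepVec (γ z s i).1 (γ z s j).1, (pv z s i j).1, (pv z s i j).2) * Pm (Θ (fun _ => 1)) z s (γ z s i).1)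 z - Kc (fun z s i _ => χ (s, (γ z s i).1) * Pm (Θ Ψ) z s (γ z s i).1) z; Literature.MathematicalPhysics.KineticTheory.localGibbsLaw σ a₀ u₀ θ₀ N (Φ N) {z | η < |D z|} ≤ ENNReal.ofReal δ

/-- item stmt-AtomisticToContinuum-3988 · crux · rank 3 · closed · moot by None · by planner
why it might fail: a history-dependent collision rate (λ not a function of the instantaneous local density) or a dynamical contact value ≠ thermodynamic Y out of equilibrium — conceivable exactly where ContactChaos fails; beyond the fluid branch Y from hsExcessFreeEnergy is not the contact value (hence the cutoff η₀).
sources: VanbeijerenErnst1973, Resibois1978, Lachowicz1998, Ruelle1969, LebowitzPenrose1964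
[crux] RATE / CONTACT-VALUE IDENTIFICATION (card crux 2, Enskog form B). There is a universal η₀ > 0
such that for σ < σ₀(profiles), local Gibbs data, every τ, χ and every continuous cutoff g vanishing
on [η₀, ∞): K_N[χ·g(σ³ρ^N_r)] − σ³ ∫_0^τ∫_{𝕋³} χ g(σ³ρ^N_r) Y(σ³ρ^N_r) B¹_r dx ds → 0 in probability
(N → ∞ then r → 0), with ρ^N_r the r-mollified empirical density, B¹_r = ∫∫ π|v−w| (mollified
μ^N_s⊗μ^N_s) and Y(η) = (3/2π)·deriv hsExcessFreeEnergy η the thermodynamic contact value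
((Z−1)/((2π/3)η)). In the limit: κ̄_{t,x}(1) = σ³ Y(σ³ρ̄) π∫∫|v−w| μ̄_{t,x} μ̄_{t,x} wherever σ³ρ̄ <
η₀ — the Enskog collision frequency, which with ContactChaos and Maxwellian μ̄ yields p = hsPressure
σ ρ θ exactly (kinetic ρθ + collisional transfer (2π/3)σ³Yρ²θ). [deps: ContactChaos] [difficulty:
open-problem] -/
@[route_item "route-AtomisticToContinuum-CollisionMeasureChaos"]
def CollisionRate : Prop :=
  ∃ η₀ : ℝ, 0 < η₀ ∧ ∀ (a₀ θ₀ : Literature.MathematicalPhysics.KineticTheory.T3 → ℝ) (u₀ : Literature.MathematicalPhysics.KineticTheory.T3 → Literature.MathematicalPhysics.KineticTheory.V3), Continuous a₀ → Continuous θ₀ → Continuous u₀ → (∀ x, 0 < a₀ x) → (∀ x, 0 < θ₀ x) → ∃ σ₀ : ℝ, 0 < σ₀ ∧ ∀ σ : ℝ, 0 < σ → σ < σ₀ → ∀ Φ : (N : ℕ) → Literature.Analysis.FluidPDE.HardSphereFlow (Literature.Analysis.FluidPDE.Torus.geometry (Fin 3)) (Literature.MathematicalPhysics.KineticTheory.hsDiameter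 σ N) (N + 1), ∀ τ : ℝ, 0 < τ → ∀ χ : ℝ × Literature.MathematicalPhysics.KineticTheory.T3 → ℝ, Continuous χ → ∀ g : ℝ → ℝ, Continuous g → (∀ a, η₀ ≤ a → g a = 0) → ∀ η δ : ℝ, 0 < η → 0 < δ → ∃ r₀ : ℝ, 0 < r₀ ∧ ∀ r : ℝ, 0 < r → r < r₀ → ∃ N₀ : ℕ, ∀ N : ℕ, N₀ ≤ N → let ε := Literature.MathematicalPhysics.KineticTheory.hsDiameter σ N; let G : Literature.Analysis.FluidPDE.Geometry (Fin 3) Literature.MathematicalPhysics.KineticTheory.T3 := Literature.Analysis.FluidPDE.Torus.geometry (Fin 3); let γ : Literature.Analysis.FluidPDE.Config (N + 1) (Fin 3) Literature.MathematicalPhysics.KineticTheory.T3 → ℝ → Literature.Analysis.FluidPDE.Config (N + 1) (Fin 3) Literature.MathematicalPhysics.KineticTheory.T3 := fun z s => (Φ N).flow s z; let bx : Literature.MathematicalPhysics.KineticTheory.T3 → Literature.MathematicalPhysics.KineticTheory.T3 → ℝ := fun x y => 3 / (Real.pi * r ^ 3) * max (1 - Literature.Analysis.FluidPDE.Torus.euclidDist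 x y / r) 0; let ρm : Literature.Analysis.FluidPDE.Config (N + 1) (Fin 3) Literature.MathematicalPhysics.KineticTheory.T3 → ℝ → Literature.MathematicalPhysics.KineticTheory.T3 → ℝ := fun z s x₀ => ∫ q, bx q.1 x₀ ∂(Literature.Analysis.FluidPDE.empiricalMeasure (γ z s)); let B1 : Literature.Analysis.FluidPDE.Config (N + 1) (Fin 3) Literature.MathematicalPhysics.KineticTheory.T3 → ℝ → Literature.MathematicalPhysics.KineticTheory.T3 → ℝ := fun z s x₀ => ∫ p, bx p.1.1 x₀ * bx p.2.1 x₀ * (Real.pi * ‖p.1.2 - p.2.2‖) ∂((Literature.Analysis.FluidPDE.empiricalMeasure (γ z s)).prod (Literature.Analysis.FluidPDE.empiricalMeasure (γ z s))); let Kc : (Literature.Analysis.FluidPDE.Config (N + 1) (Fin 3) Literature.MathematicalPhysics.KineticTheory.T3 → ℝ → Fin (N + 1) → Fin (N + 1) → ℝ) → Literature.Analysis.FluidPDE.Config (N + 1) (Fin 3) Literature.MathematicalPhysics.KineticTheory.T3 → ℝ := fun F z => ε / (N + 1 : ℝ) * ∑ᶠ (s : ℝ) (_ : s ∈ Literature.Analysis.FluidPDE.collisionTimes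 G ε (γ z) ∩ Set.Icc 0 τ), ∑ i : Fin (N + 1), ∑ j : Fin (N + 1), (if i ≠ j ∧ ‖G.sepVec (γ z s i).1 (γ z s j).1‖ = ε then F z s i j else 0); let Y : ℝ → ℝ := fun a => 3 / (2 * Real.pi) * deriv Literature.MathematicalPhysics.KineticTheory.hsExcessFreeEnergy a; let D : Literature.Analysis.FluidPDE.Config (N + 1) (Fin 3) Literature.MathematicalPhysics.KineticTheory.T3 → ℝ := fun z => Kc (fun z s i _ => χ (s, (γ z s i).1) * g (σ ^ 3 * ρm z s (γ z s i).1)) z - σ ^ 3 * ∫ s in Set.Icc (0 : ℝ) τ, ∫ x : Literature.MathematicalPhysics.KineticTheory.T3, χ (s, x) * g (σ ^ 3 * ρm z s x) * Y (σ ^ 3 * ρm z s x) * B1 z s x; Literature.MathematicalPhysics.KineticTheory.localGibbsLaw σ a₀ u₀ θ₀ N (Φ N) {z | η < |D z|} ≤ ENNReal.ofReal δ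

/-- item stmt-AtomisticToContinuum-3989 · crux · rank 4 · closed · moot by None · by planner
why it might fail: at Euler scaling the leading entropy production vanishes by free balance; the local sign is that of the O(Kn) deviation of κ^N from product structure (Navier–Stokes-order dissipation) — physically ≥ 0, but no in-probability local second law is known for deterministic spheres.
sources: FeireislNovotny2012, BrezinaFeireisl2018, Resibois1978, OllaVaradhanYau1993, Spohn1991
[crux] LOCAL ENTROPY INEQUALITY IN PROBABILITY for the r-mollified empirical fields (ρ, m, e)^N_r
with θ = (2/3)(e/ρ − |m|²/2ρ²) and mathematical entropy H(ρ,θ) = −ρ(3/2 log θ − log ρ −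
hsExcessFreeEnergy(ρσ³)): for every smooth φ ≥ 0 supported in [0,τ) × 𝕋³, P(∫∫ H (∂_sφ + (m/ρ)·∇φ)
dx ds + ∫ H(ρ(0),θ(0)) φ(0) dx < −η) → 0 as N → ∞ then r → 0, under the conjunct's hypotheses (Euler
data (ρ,u,θ)(0) = limits of the local Gibbs fields). This is the admissibility the Feireisl–Novotný
/ Březina–Feireisl relative-energy method consumes for the COMPLETE Euler system (energy only
globally, exact here); the GLOBAL Clausius inequality in expectation is free (Liouville + Gibbs
variational bound), the local one is not. [difficulty: open-problem] -/
@[route_item "route-AtomisticToContinuum-CollisionMeasureChaos"]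
def LocalSecondLaw : Prop :=
  ∀ (a₀ θ₀ : Literature.MathematicalPhysics.KineticTheory.T3 → ℝ) (u₀ : Literature.MathematicalPhysics.KineticTheory.T3 → Literature.MathematicalPhysics.KineticTheory.V3), Continuous a₀ → Continuous θ₀ → Continuous u₀ → (∀ x, 0 < a₀ x) → (∀ x, 0 < θ₀ x) → ∃ σ₀ : ℝ, 0 < σ₀ ∧ ∀ σ : ℝ, 0 < σ → σ < σ₀ → ∀ (T : ℝ) (ρ θ : ℝ → Literature.MathematicalPhysics.KineticTheory.T3 → ℝ) (u : ℝ → Literature.MathematicalPhysics.KineticTheory.T3 → Literature.MathematicalPhysics.KineticTheory.V3), Literature.MathematicalPhysics.KineticTheory.IsHardSphereEulerSolution σ T ρ u θ → ∀ Φ : (N : ℕ) → Literature.Analysis.FluidPDE.HardSphereFlow (Literature.Analysis.FluidPDE.Torus.geometry (Fin 3)) (Literature.MathematicalPhysics.KineticTheory.hsDiameter σ N) (N + 1), Literature.MathematicalPhysics.KineticTheory.TendstoHydroFieldsAt (fun N => Literature.MathematicalPhysics.KineticTheory.localGibbsLaw σ a₀ u₀ θ₀ N (Φ N)) Φ ρ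 u θ 0 → 0 < T → ∀ τ : ℝ, 0 < τ → ∀ φ : ℝ → Literature.MathematicalPhysics.KineticTheory.T3 → ℝ, Literature.Analysis.FunctionSpaces.Torus.IsSmoothSpaceTimeOn Set.univ φ → (∀ s x, 0 ≤ φ s x) → (∃ τ' : ℝ, τ' < τ ∧ ∀ s, τ' ≤ s → ∀ x, φ s x = 0) → ∀ η δ : ℝ, 0 < η → 0 < δ → ∃ r₀ : ℝ, 0 < r₀ ∧ ∀ r : ℝ, 0 < r → r < r₀ → ∃ N₀ : ℕ, ∀ N : ℕ, N₀ ≤ N → let γ : Literature.Analysis.FluidPDE.Config (N + 1) (Fin 3) Literature.MathematicalPhysics.KineticTheory.T3 → ℝ → Literature.Analysis.FluidPDE.Config (N + 1) (Fin 3) Literature.MathematicalPhysics.KineticTheory.T3 := fun z s => (Φ N).flow s z; let bx : Literature.MathematicalPhysics.KineticTheory.T3 → Literature.MathematicalPhysics.KineticTheory.T3 → ℝ := fun x y => 3 / (Real.pi * r ^ 3) * max (1 - Literature.Analysis.FluidPDE.Torus.euclidDist x y / r) 0; let ρm : Literature.Analysis.FluidPDE.Config (N + 1) (Fin 3) Literature.MathematicalPhysics.KineticTheory.T3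 → ℝ → Literature.MathematicalPhysics.KineticTheory.T3 → ℝ := fun z s x₀ => ∫ q, bx q.1 x₀ ∂(Literature.Analysis.FluidPDE.empiricalMeasure (γ z s)); let mm : Literature.Analysis.FluidPDE.Config (N + 1) (Fin 3) Literature.MathematicalPhysics.KineticTheory.T3 → ℝ → Literature.MathematicalPhysics.KineticTheory.T3 → Literature.MathematicalPhysics.KineticTheory.V3 := fun z s x₀ => ∫ q, bx q.1 x₀ • q.2 ∂(Literature.Analysis.FluidPDE.empiricalMeasure (γ z s)); let em : Literature.Analysis.FluidPDE.Config (N + 1) (Fin 3) Literature.MathematicalPhysics.KineticTheory.T3 → ℝ → Literature.MathematicalPhysics.KineticTheory.T3 → ℝ := fun z s x₀ => ∫ q, bx q.1 x₀ * (‖q.2‖ ^ 2 / 2) ∂(Literature.Analysis.FluidPDE.empiricalMeasure (γ z s)); let θm : Literature.Analysis.FluidPDE.Config (N + 1) (Fin 3) Literature.MathematicalPhysics.KineticTheory.T3 → ℝ → Literature.MathematicalPhysics.KineticTheory.T3 → ℝ := fun z s x₀ => 2 / 3 * (em z s x₀ / ρm z s x₀ - ‖mm z s x₀‖ ^ 2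 / (2 * ρm z s x₀ ^ 2)); let Hs : ℝ → ℝ → ℝ := fun a b => if 0 < a ∧ 0 < b then -(a * (3 / 2 * Real.log b - Real.log a - Literature.MathematicalPhysics.KineticTheory.hsExcessFreeEnergy (a * σ ^ 3))) else 0; let I : Literature.Analysis.FluidPDE.Config (N + 1) (Fin 3) Literature.MathematicalPhysics.KineticTheory.T3 → ℝ := fun z => ∫ s in Set.Icc (0 : ℝ) τ, ∫ x : Literature.MathematicalPhysics.KineticTheory.T3, Hs (ρm z s x) (θm z s x) * (deriv (fun s' => φ s' x) s + ∑ k : Fin 3, (mm z s x) k / ρm z s x * Literature.Analysis.FunctionSpaces.Torus.partialDeriv k (φ s) x); Literature.MathematicalPhysics.KineticTheory.localGibbsLaw σ a₀ u₀ θ₀ N (Φ N) {z | I z + ∫ x : Literature.MathematicalPhysics.KineticTheory.T3, Hs (ρ 0 x) (θ 0 x) * φ 0 x < -η} ≤ ENNReal.ofReal δ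

/-- item stmt-AtomisticToContinuum-3990 · crux · rank 5 · closed · moot by None · by planner
why it might fail: transient mesoscopic pre-crystalline clusters ahead of steepening compressive waves; there is no maximum principle for the empirical density of the particle system, and for implosion-type data the Euler density itself leaves the fluid branch near T (statement-level hazard shared by all routes).
sources: Spohn1991, OllaVaradhanYau1993, Ruelle1969
[crux] NO OVERCOMPRESSION BEFORE THE SHOCK: under the conjunct's hypotheses, for every t < T and η >
0, P(∃ s ≤ t, ∃ x: ρ^N_r(s,x) > ρ(s,x) + η) → 0 as N → ∞ then r → 0 (ρ = the classical Euler
density). Needed because on sets of reduced density ≥ η₀ the collisional fluxes are neither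
identified (CollisionRate is cut off) nor a priori bounded (contact values blow up toward close
packing), so they cannot be absorbed in the relative-energy Gronwall; at each FIXED scale r a
scale-dependent cap is free by entropy transfer against the invariant Gibbs law, the scale-uniform
one-sided bound is not. [difficulty: L] -/
@[route_item "route-AtomisticToContinuum-CollisionMeasureChaos"]
def DensityCap : Prop :=
  ∀ (a₀ θ₀ : Literature.MathematicalPhysics.KineticTheory.T3 → ℝ) (u₀ : Literature.MathematicalPhysics.KineticTheory.T3 → Literature.MathematicalPhysics.KineticTheory.V3), Continuous a₀ → Continuous θ₀ → Continuous u₀ → (∀ x, 0 < a₀ x) → (∀ x, 0 < θ₀ x) → ∃ σ₀ : ℝ, 0 < σ₀ ∧ ∀ σ : ℝ, 0 < σ → σ < σ₀ → ∀ (T : ℝ) (ρ θ : ℝ → Literature.MathematicalPhysics.KineticTheory.T3 → ℝ) (u : ℝ → Literature.MathematicalPhysics.KineticTheory.T3 → Literature.MathematicalPhysics.KineticTheory.V3), Literature.MathematicalPhysics.KineticTheory.IsHardSphereEulerSolution σ T ρ u θ → ∀ Φ : (N : ℕ) → Literature.Analysis.FluidPDE.HardSphereFlow (Literature.Analysis.FluidPDE.Torus.geometry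 (Fin 3)) (Literature.MathematicalPhysics.KineticTheory.hsDiameter σ N) (N + 1), Literature.MathematicalPhysics.KineticTheory.TendstoHydroFieldsAt (fun N => Literature.MathematicalPhysics.KineticTheory.localGibbsLaw σ a₀ u₀ θ₀ N (Φ N)) Φ ρ u θ 0 → ∀ t ∈ Set.Ico 0 T, ∀ η δ : ℝ, 0 < η → 0 < δ → ∃ r₀ : ℝ, 0 < r₀ ∧ ∀ r : ℝ, 0 < r → r < r₀ → ∃ N₀ : ℕ, ∀ N : ℕ, N₀ ≤ N → let γ : Literature.Analysis.FluidPDE.Config (N + 1) (Fin 3) Literature.MathematicalPhysics.KineticTheory.T3 → ℝ → Literature.Analysis.FluidPDE.Config (N + 1) (Fin 3) Literature.MathematicalPhysics.KineticTheory.T3 := fun z s => (Φ N).flow s z; let bx : Literature.MathematicalPhysics.KineticTheory.T3 → Literature.MathematicalPhysics.KineticTheory.T3 → ℝ := fun x y => 3 / (Real.pi * r ^ 3) * max (1 - Literature.Analysis.FluidPDE.Torus.euclidDist x y / r) 0; let ρm : Literature.Analysis.FluidPDE.Config (N + 1) (Fin 3) Literature.MathematicalPhysics.KineticTheory.T3 →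 ℝ → Literature.MathematicalPhysics.KineticTheory.T3 → ℝ := fun z s x₀ => ∫ q, bx q.1 x₀ ∂(Literature.Analysis.FluidPDE.empiricalMeasure (γ z s)); Literature.MathematicalPhysics.KineticTheory.localGibbsLaw σ a₀ u₀ θ₀ N (Φ N) {z | ∃ s ∈ Set.Icc 0 t, ∃ x : Literature.MathematicalPhysics.KineticTheory.T3, ρ s x + η < ρm z s x} ≤ ENNReal.ofReal δ

/-- item stmt-AtomisticToContinuum-0768 · support · rank 9 · open · by planner
sources: Ruelle1969, LebowitzPenrose1964
[support] Hard-sphere equation of state at low density: ∃ η₀ > 0 and F real-analytic on (−η₀, η₀)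
with hsExcessFreeEnergy = F on [0, η₀), F(0) = 0, F'(0) = 2π/3 (second virial coefficient of
unit-diameter spheres), and the canonical thermodynamic limit −N⁻¹ log hsFreeVolume η N → F(η)
exists (not just limsup) for η ∈ [0, η₀). Ruelle1969 §3.4 (existence), LebowitzPenrose1964
(convergence of the virial expansion ⇒ analyticity). Makes hsCompressibility/hsPressure smooth and
Z(η) = 1 + (2π/3)η + O(η²); needed by every route (hyperbolicity of the Euler system, virial
theorem). -/
@[route_item "route-AtomisticToContinuum-CollisionMeasureChaos"]
def HsEosLowDensity : Prop :=
  ∃ η₀ : ℝ, 0 < η₀ ∧ ∃ F : ℝ → ℝ, AnalyticOnNhd ℝ F (Set.Ioo (-η₀) η₀) ∧ Set.EqOn Literature.MathematicalPhysics.KineticTheory.hsExcessFreeEnergy F (Set.Ico 0 η₀) ∧ F 0 = 0 ∧ deriv F 0 = 2 * Real.pi / 3 ∧ ∀ η ∈ Set.Ico 0 η₀, Filter.Tendsto (fun N : ℕ => -(N : ℝ)⁻¹ * Real.log (Literature.MathematicalPhysics.KineticTheory.hsFreeVolume η N)) Filter.atTop (nhds (F η))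

/-- item stmt-AtomisticToContinuum-3991 · support · rank 9 · closed · moot by None · by planner
sources: arXiv:1504.03215, GST2013, Spohn1991
[support] tightness of the normalised collision count (card S1): for σ < σ₀(profiles), every τ and δ
there are K, N₀ with P((ε/(N+1))·#collisions in [0,τ] > K) ≤ δ for N ≥ N₀ (ε = hsDiameter σ N;
#collisions = FP.numCollisions of the flow trajectory). Expected proof: Cauchy–Schwarz transfer of
an equilibrium large-deviation bound for excess collision counts from the invariant canonical Gibbs
law (card spacetime-superextensive-ld); not routine (super-extensive count N^{4/3}). [difficulty: M] -/
@[route_item "route-AtomisticToContinuum-CollisionMeasureChaos"]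
def CollisionTightness : Prop :=
  ∀ (a₀ θ₀ : Literature.MathematicalPhysics.KineticTheory.T3 → ℝ) (u₀ : Literature.MathematicalPhysics.KineticTheory.T3 → Literature.MathematicalPhysics.KineticTheory.V3), Continuous a₀ → Continuous θ₀ → Continuous u₀ → (∀ x, 0 < a₀ x) → (∀ x, 0 < θ₀ x) → ∃ σ₀ : ℝ, 0 < σ₀ ∧ ∀ σ : ℝ, 0 < σ → σ < σ₀ → ∀ Φ : (N : ℕ) → Literature.Analysis.FluidPDE.HardSphereFlow (Literature.Analysis.FluidPDE.Torus.geometry (Fin 3)) (Literature.MathematicalPhysics.KineticTheory.hsDiameter σ N) (N + 1), ∀ τ : ℝ, 0 < τ → ∀ δ : ℝ, 0 < δ → ∃ K : ℝ, ∃ N₀ : ℕ, ∀ N : ℕ, N₀ ≤ N → Literature.MathematicalPhysics.KineticTheory.localGibbsLaw σ a₀ u₀ θ₀ N (Φ N) {z | K < Literature.MathematicalPhysics.KineticTheory.hsDiameter σ N / (N + 1 : ℝ) * (Literature.Analysis.FluidPDE.numCollisions (Literature.Analysis.FluidPDE.Torus.geometry (Fin 3)) (Literature.MathematicalPhysics.KineticTheory.hsDiameter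 σ N) (fun s => (Φ N).flow s z) 0 τ : ℝ)} ≤ ENNReal.ofReal δ

/-- item stmt-AtomisticToContinuum-3992 · support · rank 9 · closed · moot by None · by planner
sources: LuMouhot2015, CercignaniIllnerPulvirenti1994, Villani2002
[support] Boltzmann's uniqueness of collision equilibria, MEASURE version (card S3): a finite Borel
measure m on ℝ³ with finite second moment whose product kernel is collisionally balanced, ∫∫∫
((v−w)·ω)₊ [φ(v′)+φ(w′)−φ(v)−φ(w)] dω m(dv) m(dw) = 0 for all bounded continuous φ, is a (possibly
zero) point mass or ρ·Maxwellian(θ,u)·Lebesgue with ρ, θ > 0. [difficulty: M] -/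
@[route_item "route-AtomisticToContinuum-CollisionMeasureChaos"]
def BalanceRigidity : Prop :=
  ∀ (m : MeasureTheory.Measure Literature.MathematicalPhysics.KineticTheory.V3) [MeasureTheory.IsFiniteMeasure m], MeasureTheory.Integrable (fun v => ‖v‖ ^ 2) m → (∀ φ : Literature.MathematicalPhysics.KineticTheory.V3 → ℝ, Continuous φ → (∃ C : ℝ, ∀ v, |φ v| ≤ C) → ∫ v, ∫ w, ∫ ω : Metric.sphere (0 : Literature.MathematicalPhysics.KineticTheory.V3) 1, Literature.MathematicalPhysics.KineticTheory.hardSphereKernel (v, w) ω * (φ (Literature.MathematicalPhysics.KineticTheory.collide ω (v, w)).1 + φ (Literature.MathematicalPhysics.KineticTheory.collide ω (v, w)).2 - φ v - φ w) ∂Literature.MathematicalPhysics.KineticTheory.sphereMeasure ∂m ∂m = 0) → (∃ c : ENNReal, ∃ u : Literature.MathematicalPhysics.KineticTheory.V3, m = c • MeasureTheory.Measure.dirac u) ∨ (∃ ρ θ : ℝ, ∃ u : Literature.MathematicalPhysics.KineticTheory.V3, 0 < ρ ∧ 0 < θ ∧ m = MeasureTheory.volume.withDensity (fun v => ENNReal.ofReal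 (Literature.Analysis.FluidPDE.localMaxwellian ρ θ u v)))

/-- item stmt-AtomisticToContinuum-3993 · support · rank 9 · closed · moot by None · by planner
sources: Bogolyubov1975, arXiv:1504.03215, GST2013
[support] the EXACT IDENTITY for empirical measures along one trajectory (card S2; Bogolyubov's
microscopic Enskog equation, torus version): for every hard-sphere flow Φ on 𝕋³ (any ε > 0, N),
every good z, τ > 0, a ∈ C¹(ℝ), smooth b on 𝕋³ and any c on ℝ³: a(τ)⟨μ_τ, b c⟩ − a(0)⟨μ_0, b c⟩ −
∫_0^τ [a′⟨μ_s, b c⟩ + a⟨μ_s, (v·∇b) c⟩] ds = N⁻¹ Σ_{collision times s ∈ (0,τ]} a(s) Σ_{ordered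
contact pairs (i,j)} b(x_i)[c(v_i) − c((reflectVel (x_i−x_j) (v_i,v_j)).1)] (μ_s = empiricalMeasure
of Φ_s z; right-continuous trajectories, pre-collisional velocities by the involution reflectVel).
[difficulty: provable-now] -/
@[route_item "route-AtomisticToContinuum-CollisionMeasureChaos"]
def EmpiricalEnskogIdentity : Prop :=
  ∀ (ε : ℝ) (N : ℕ), 0 < ε → ∀ Φ : Literature.Analysis.FluidPDE.HardSphereFlow (Literature.Analysis.FluidPDE.Torus.geometry (Fin 3)) ε N, ∀ z ∈ Φ.good, ∀ τ : ℝ, 0 < τ → ∀ a : ℝ → ℝ, ContDiff ℝ 1 a → ∀ b : Literature.MathematicalPhysics.KineticTheory.T3 → ℝ, Literature.Analysis.FunctionSpaces.Torus.IsSmooth b → ∀ c : Literature.MathematicalPhysics.KineticTheory.V3 → ℝ, let G : Literature.Analysis.FluidPDE.Geometry (Fin 3) Literature.MathematicalPhysics.KineticTheory.T3 := Literature.Analysis.FluidPDE.Torus.geometry (Fin 3); let γ : ℝ → Literature.Analysis.FluidPDE.Config N (Fin 3) Literature.MathematicalPhysics.KineticTheory.T3 := fun s => Φ.flow s z; a τ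 * ∫ q, b q.1 * c q.2 ∂(Literature.Analysis.FluidPDE.empiricalMeasure (γ τ)) - a 0 * ∫ q, b q.1 * c q.2 ∂(Literature.Analysis.FluidPDE.empiricalMeasure (γ 0)) - ∫ s in Set.Icc (0 : ℝ) τ, (deriv a s * ∫ q, b q.1 * c q.2 ∂(Literature.Analysis.FluidPDE.empiricalMeasure (γ s)) + a s * ∫ q, (∑ k : Fin 3, q.2 k * Literature.Analysis.FunctionSpaces.Torus.partialDeriv k b q.1) * c q.2 ∂(Literature.Analysis.FluidPDE.empiricalMeasure (γ s))) = (N : ℝ)⁻¹ * ∑ᶠ (s : ℝ) (_ : s ∈ Literature.Analysis.FluidPDE.collisionTimes G ε γ ∩ Set.Ioc 0 τ), a s * ∑ i : Fin N, ∑ j : Fin N, (if i ≠ j ∧ ‖G.sepVec (γ s i).1 (γ s j).1‖ = ε then b (γ s i).1 * (c (γ s i).2 - c (Literature.Analysis.FluidPDE.reflectVel (G.sepVec (γ s i).1 (γ s j).1) ((γ s i).2, (γ s j).2)).1) else 0)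

/-- item stmt-AtomisticToContinuum-3994 · assembly · rank 1 · closed · moot by None · by planner
sources: BrezinaFeireisl2018, FeireislNovotny2012, Dafermos1979, SaintRaymond2009, Spohn1991
[assembly] ContactChaos → CollisionRate → LocalSecondLaw → DensityCap → HydrodynamicLimit
(compactness, free balance, rigidity, flux bookkeeping and complete-Euler weak–strong uniqueness
inside). -/
@[route_item "route-AtomisticToContinuum-CollisionMeasureChaos"]
def Assembly : Prop :=
  ContactChaos → CollisionRate → LocalSecondLaw → DensityCap → Literature.MathematicalPhysics.KineticTheory.HydrodynamicLimit

end Summit.AtomisticToContinuum.HydrodynamicLimit.Theses.CollisionMeasureChaos
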